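import Summits.SmoothPoincare4.SmoothPoincare4.Theses.EntropyRung
import Literature.Geometry.Riemannian.BakryEmeryLogSobolev
import Literature.Geometry.Riemannian.WeightedHeatFlowFromLinearHeat
import Literature.Geometry.Riemannian.LinearHeatCauchyExistence
import HarnessLib

/-!
# SmoothPoincare4 / EntropyRung — `BakryEmeryLogSobolev` (item stmt-SmoothPoincare4-16587)

The support item `BakryEmeryLogSobolev` of route EntropyRung is the textbook Bakry–Émery logarithmic
Sobolev inequality of a complete `CD(K, ∞)` weighted Riemannian manifold, `K > 0` (Bakry–Émery 1985;
Carrillo–Ni 2009, Thm. 3.1; Bakry–Gentil–Ledoux 2014, Prop. 5.7.1): the text of the Literature named fact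
`Literature.Geometry.Riemannian.bakryEmery_logSobolev_complete` (`BakryEmeryLogSobolev.lean`) with the total
forms `g.riemVolume` / `g.riemEDist` unfolded one step (`riemVolume_eq` / `riemEDist_eq`) to the route
file's fact-free vocabulary `riemannianMeasure (g.toContMDiffRiemannianMetric hg)` / `g.edist hg`.

This file records, sorry-free:

* `bakryEmeryLogSobolev_of_fact` / `fact_of_bakryEmeryLogSobolev` — the item and the named fact are
  EQUIVALENT (each direction is the two rewrites `riemVolume_eq hg`, `riemEDist_eq hg`); so the item closes
  by one line from `bakryEmery_logSobolev_complete_holds` the moment the fact is discharged, and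
  conversely a proof of the item discharges the fact;
* `bakryEmeryLogSobolev_of_compactSpace` — **the closed case of the item is a THEOREM of the tree**:
  for compact `M` (where completeness, the second moment and the Fisher proviso are automatic or idle)
  the inequality is the tree's Bakry–Émery heat-flow argument `logSobolev_of_heatExistence`
  (`WeightedHeatFlowAPriori.lean`) fed with the weighted heat flow, which exists by conjugation
  (`heatDrift_finite_of_staticLinearHeat`), gluing in time (`heatDrift_global_of_finite`) and the
  linear parabolic existence theorem `exists_staticLinearHeat` (`LinearHeatCauchyExistence.lean`,
  Friedman 1964, Ch. 3, Thm. 7 — proved in the tree by Lions' method).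

What is NOT here: the complete non-compact case (the heat semigroup `e^{tL}`, `L = Δ − ∇V·∇`, on a
complete weighted manifold with the Bakry–Ledoux commutation `|∇P_t f|² ≤ e^{-2Kt} P_t|∇f|²`, or the
HWI inequality by optimal transport — neither is in Mathlib or the tree); it is exactly the named fact.

References: [CarrilloNi2009] Thm. 3.1 (p. 7); [BakryGentilLedoux2014] Prop. 5.7.1, Cor. 5.7.2 (p. 268);
[BakryEmery1985]; [Friedman1964] Ch. 3, Thm. 7.
-/

noncomputable section

-- the registered namespace `Summit.SmoothPoincare4.SmoothPoincare4.Theorems` repeats a component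
set_option linter.dupNamespace false

open scoped Manifold ContDiff ENNReal NNReal Topology
open MeasureTheory Set Filter
open Literature.Geometry.Lorentzian Literature.Geometry.Riemannian

namespace Summit.SmoothPoincare4.SmoothPoincare4.Theorems

open Summit.SmoothPoincare4.SmoothPoincare4.Theses.EntropyRung

/-- **The item from the named fact.** `BakryEmeryLogSobolev` is `bakryEmery_logSobolev_complete` with
`g.riemVolume` and `g.riemEDist` rewritten by `riemVolume_eq hg` / `riemEDist_eq hg`; so
`bakryEmery_logSobolev_complete_holds`, once it lands, closes stmt-SmoothPoincare4-16587 by this lemma.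
[cite: CarrilloNi2009, Thm. 3.1 (p. 7)] [cite: BakryGentilLedoux2014, Prop. 5.7.1 and Cor. 5.7.2 (p. 268)] -/
theorem bakryEmeryLogSobolev_of_fact (h : bakryEmery_logSobolev_complete) :
    Summit.SmoothPoincare4.SmoothPoincare4.Theses.EntropyRung.BakryEmeryLogSobolev := by
  unfold BakryEmeryLogSobolev
  intro n M _ _ _ _ _ _ _ _ _ g _ V K hg hc hV hK hRic hmass φ hφ hφmass h2 hI
  have hc' : ∀ (x : M) (r : NNReal), IsCompact {y : M | g.riemEDist x y ≤ r} := fun x r ↦ by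
    simpa only [PseudoRiemannianMetric.riemEDist_eq hg] using hc x r
  have key := h n M g V K hg hc' hV hK hRic
  simp only [PseudoRiemannianMetric.riemVolume_eq hg, PseudoRiemannianMetric.riemEDist_eq hg] at key
  exact key hmass φ hφ hφmass h2 hI

/-- **The named fact from the item** (converse bridge): a proof of `BakryEmeryLogSobolev` discharges
`Literature.Geometry.Riemannian.bakryEmery_logSobolev_complete` (rewrite `riemVolume_eq hg`,
`riemEDist_eq hg` the other way). [cite: CarrilloNi2009, Thm. 3.1 (p. 7)] -/
theorem fact_of_bakryEmeryLogSobolev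
    (h : Summit.SmoothPoincare4.SmoothPoincare4.Theses.EntropyRung.BakryEmeryLogSobolev) :
    bakryEmery_logSobolev_complete := by
  intro n M _ _ _ _ _ _ _ _ _ g _ V K hg hc hV hK hRic hmass φ hφ hφmass h2 hI
  have hc' : ∀ (x : M) (r : NNReal), IsCompact {y : M | g.edist hg x y ≤ r} := fun x r ↦ by
    simpa only [PseudoRiemannianMetric.riemEDist_eq hg] using hc x r
  have key := h n M g V K hg hc' hV hK hRic
  simp only [PseudoRiemannianMetric.riemVolume_eq hg, PseudoRiemannianMetric.riemEDist_eq hg]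
    at hmass hφmass h2 hI ⊢
  exact key hmass φ hφ hφmass h2 hI

/-- **The closed case of the item is proved.** For `M` compact (connected, modelled on `ℝⁿ`), `g`
Riemannian with its Levi-Civita connection, `V` smooth with `K g ≤ Ric + Hess V` on the diagonal,
`K > 0`, `∫ e^{-V} dV_g = 1`, and every smooth `φ` with `∫ e^{φ} e^{-V} dV_g = 1`:
`∫ φ e^{φ} e^{-V} dV_g ≤ (2K)⁻¹ ∫ |∇φ|²_g e^{φ} e^{-V} dV_g` — the tree's heat-flow proof
`logSobolev_of_heatExistence` (minimum principle, Bakry–Émery gradient bound, convergence to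
equilibrium, entropy dissipation `dH/dt = −I`, `dI/dt ≤ −2K I`) with the weighted heat flow supplied by
`exists_staticLinearHeat` (Friedman 1964, Ch. 3, Thm. 7, proved in the tree), conjugation by `e^{V/2}`
(`heatDrift_finite_of_staticLinearHeat`) and gluing in time (`heatDrift_global_of_finite`). On a compact
manifold the completeness, second-moment and Fisher provisos of the item are idle.
[cite: CarrilloNi2009, §3 (pp. 7–8)] [cite: Friedman1964, Ch. 3, Thm. 7] -/
theorem bakryEmeryLogSobolev_of_compactSpace {n : ℕ} {M : Type} [TopologicalSpace M] [T2Space M]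
    [SecondCountableTopology M] [ChartedSpace (EuclideanSpace ℝ (Fin n)) M] [IsManifold (𝓡 n) ∞ M]
    [ConnectedSpace M] [T3Space M] [MeasurableSpace M] [BorelSpace M] [CompactSpace M]
    (g : PseudoRiemannianMetric (𝓡 n) ∞ (EuclideanSpace ℝ (Fin n)) (TangentSpace (𝓡 n) : M → Type _))
    [g.HasLeviCivita] (V : M → ℝ) (K : ℝ) (hg : g.IsRiemannian)
    (hV : ContMDiff (𝓡 n) 𝓘(ℝ, ℝ) ∞ V) (hK : 0 < K)
    (hRic : ∀ (x : M) (X : TangentSpace (𝓡 n) x),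
      K * g.val x X X ≤ g.ricci x X X + g.hessian V x X X)
    (hmass : ∫ x, Real.exp (-V x) ∂(riemannianMeasure (g.toContMDiffRiemannianMetric hg)) = 1)
    (φ : M → ℝ) (hφ : ContMDiff (𝓡 n) 𝓘(ℝ, ℝ) ∞ φ)
    (hφmass : ∫ x, Real.exp (φ x) * Real.exp (-V x)
      ∂(riemannianMeasure (g.toContMDiffRiemannianMetric hg)) = 1) :
    ∫ x, φ x * (Real.exp (φ x) * Real.exp (-V x))
        ∂(riemannianMeasure (g.toContMDiffRiemannianMetric hg)) ≤
      1 / (2 * K) * ∫ x, g.gradSq φ x * (Real.exp (φ x) * Real.exp (-V x))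
        ∂(riemannianMeasure (g.toContMDiffRiemannianMetric hg)) := by
  rw [← PseudoRiemannianMetric.riemVolume_eq hg] at hmass hφmass ⊢
  exact logSobolev_of_heatExistence g hg hK hV hRic hmass
    (fun h₀ hh₀ ↦ heatDrift_global_of_finite g hg
      (fun T hT k₀ hk₀ ↦ heatDrift_finite_of_staticLinearHeat g (T := T)
        (fun Q hQ w₀ hw₀ ↦ exists_staticLinearHeat g hg hT hQ hw₀) hV k₀ hk₀) h₀ hh₀) φ hφ hφmass

/-- **The item restricted to closed manifolds** — `BakryEmeryLogSobolev` with the extra hypothesis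
`[CompactSpace M]`, as a closed `Prop`-level corollary of `bakryEmeryLogSobolev_of_compactSpace` (the
completeness, second-moment and Fisher hypotheses are simply dropped). [cite: CarrilloNi2009, §3 (pp. 7–8)] -/
theorem bakryEmeryLogSobolev_compact :
    ∀ (n : ℕ) (M : Type) [TopologicalSpace M] [T2Space M] [SecondCountableTopology M]
      [ChartedSpace (EuclideanSpace ℝ (Fin n)) M] [IsManifold (𝓡 n) ∞ M] [ConnectedSpace M] [T3Space M]
      [MeasurableSpace M] [BorelSpace M] [CompactSpace M]
      (g : PseudoRiemannianMetric (𝓡 n) ∞ (EuclideanSpace ℝ (Fin n)) (TangentSpace (𝓡 n) : M → Type _))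
      [g.HasLeviCivita] (V : M → ℝ) (K : ℝ) (hg : g.IsRiemannian),
      (∀ (x : M) (r : NNReal), IsCompact {y : M | g.edist hg x y ≤ r}) →
      ContMDiff (𝓡 n) 𝓘(ℝ, ℝ) ∞ V → 0 < K →
      (∀ (x : M) (X : TangentSpace (𝓡 n) x), K * g.val x X X ≤ g.ricci x X X + g.hessian V x X X) →
      ∫ x, Real.exp (-V x) ∂(riemannianMeasure (g.toContMDiffRiemannianMetric hg)) = 1 →
      ∀ φ : M → ℝ, ContMDiff (𝓡 n) 𝓘(ℝ, ℝ) ∞ φ →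
        ∫ x, Real.exp (φ x) * Real.exp (-V x) ∂(riemannianMeasure (g.toContMDiffRiemannianMetric hg)) = 1 →
        (∃ o : M, Integrable (fun x ↦ (g.edist hg o x).toReal ^ 2 * (Real.exp (φ x) * Real.exp (-V x)))
          (riemannianMeasure (g.toContMDiffRiemannianMetric hg))) →
        Integrable (fun x ↦ g.gradSq φ x * (Real.exp (φ x) * Real.exp (-V x)))
          (riemannianMeasure (g.toContMDiffRiemannianMetric hg)) →
        ∫ x, φ x * (Real.exp (φ x) * Real.exp (-V x))
            ∂(riemannianMeasure (g.toContMDiffRiemannianMetric hg)) ≤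
          1 / (2 * K) * ∫ x, g.gradSq φ x * (Real.exp (φ x) * Real.exp (-V x))
            ∂(riemannianMeasure (g.toContMDiffRiemannianMetric hg)) := by
  intro n M _ _ _ _ _ _ _ _ _ _ g _ V K hg _hc hV hK hRic hmass φ hφ hφmass _h2 _hI
  exact bakryEmeryLogSobolev_of_compactSpace g V K hg hV hK hRic hmass φ hφ hφmass

end Summit.SmoothPoincare4.SmoothPoincare4.Theorems

end
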